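import Summits.Langlands.Langlands.Theses.QuarterDeficit1951
import Literature.NumberTheory.GaloisRepresentations.GaloisRepUnramifiedProofs
import Literature.NumberTheory.GaloisRepresentations.TateUnramifiedLiftingHolds
import Literature.NumberTheory.GaloisRepresentations.DirichletCharacterOfGaloisCharacter
import Literature.FieldTheory.AlgClosed.PadicAlgClEquivComplex
import Literature.NumberTheory.Automorphic.BCDTTheoremBWildAtThreeDet
import Literature.NumberTheory.GaloisRepresentations.IntegralGaloisActionProofs
import Summits.Langlands.Langlands.Theorems.QuarterDeficit1951IcosahedralSupplyStubDmLocal1951CardInertia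
import Summits.Langlands.Langlands.Theorems.QuarterDeficit1951IcosahedralSupplyStubDmLocal1951InertiaCyclic
import Summits.Langlands.Langlands.Theorems.QuarterDeficit1951IcosahedralSupplyStubDmLocal1951Decomposition

/-!
# Route `QuarterDeficit1951` (Langlands) — crux `IcosahedralSupply` (stmt-Langlands-15899), line `Sketch`

The stub `stub_dmLocal1951` (local behaviour of the Doud–Moore quintic field at `1951`, "type
3a"), assembled from its three registered helper stubs:

* `dmLocal1951_five_dvd_card_inertia_map` — `5 ∣ #e₀(I_𝔓)` for `𝔓 ∣ 1951` (the shifted quintic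
  `f(x - 390)` is Eisenstein at `1951`);
* `dmLocal1951_inertia_map_eq_zpowers` — `e₀(I_𝔓)` is cyclic, generated by the image of one
  element of `I_𝔓` (wild inertia dies in `S₅`, tame inertia is pro-cyclic);
* `dmLocal1951_decomposition_map_eq_zpowers` — if `e₀(I_𝔓) = ⟨g⟩` with `g` of order `5` then
  `e₀(D_𝔓) = ⟨g⟩` (Frobenius acts on tame inertia by `u ↦ u^1951 = u`; the centraliser of a
  `5`-cycle in `S₅` is `⟨g⟩`).

Glue: the kernel of `e₀` is the finite intersection of the open stabilisers of the roots, and an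
element of `S₅` whose order is divisible by `5` has order exactly `5`.
-/

set_option linter.dupNamespace false

noncomputable section

open scoped NumberField MatrixGroups
open Field IsDedekindDomain Polynomial
open Literature.NumberTheory.GaloisRepresentations Literature.NumberTheory.PAdicHodge

namespace Summit.Langlands.Langlands.Theorems.QuarterDeficit1951

/-- In `S₅` every element satisfies `g ^ 12 = 1` or `g ^ 5 = 1` (orders `1, 2, 3, 4, 6` or `5`).
[folklore] -/
theorem perm_five_pow_twelve_or_pow_five (g : Equiv.Perm (Fin 5)) : g ^ 12 = 1 ∨ g ^ 5 = 1 := by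
  revert g
  set_option maxRecDepth 100000 in
  decide

/-- An element of `S₅` whose order is divisible by `5` has order exactly `5`. [folklore] -/
theorem perm_five_orderOf_eq_five_of_dvd (g : Equiv.Perm (Fin 5)) (h : 5 ∣ orderOf g) :
    orderOf g = 5 := by
  rcases perm_five_pow_twelve_or_pow_five g with h12 | h5
  · exact absurd (h.trans (orderOf_dvd_of_pow_eq_one h12)) (by norm_num)
  · rcases (Nat.dvd_prime (by norm_num : Nat.Prime 5)).1 (orderOf_dvd_of_pow_eq_one h5) with h1 | h5'
    · rw [h1] at h; exact absurd h (by norm_num)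
    · exact h5'

/-- **Stub `stub_dmLocal1951` (Doud–Moore field, local behaviour at `1951`: type 3a).**  For the
permutation representation `e₀ : Γ_ℚ → S₅` on the roots of the Doud–Moore quintic
`x⁵ − x⁴ − 780x³ + 9911x² − 24208x + 15952` and every prime `𝔓` above `1951`, the inertia and the
decomposition images coincide and are cyclic of order `5`: `1951` is totally and tamely ramified
in the quintic field (`f(x − 390)` is Eisenstein), and Frobenius acts trivially on the tame
inertia image since `1951 ≡ 1 (mod 5)`. [cite: DoudMoore2006, §2 and §4] -/
theorem stub_dmLocal1951 (θ : Fin 5 → absIntegers (𝓞 ℚ) ℚ)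
    (hroot : ∀ i, θ i ^ 5 - θ i ^ 4 - 780 * θ i ^ 3 + 9911 * θ i ^ 2 - 24208 * θ i + 15952 = 0)
    (hinj : Function.Injective θ)
    (hall : ∀ x : AlgebraicClosure ℚ, x ^ 5 - x ^ 4 - 780 * x ^ 3 + 9911 * x ^ 2 - 24208 * x + 15952 = 0 →
      ∃ i, x = θ i)
    (e₀ : absoluteGaloisGroup ℚ →* Equiv.Perm (Fin 5))
    (he₀ : ∀ (σ : absoluteGaloisGroup ℚ) (i : Fin 5), σ • θ i = θ (e₀ σ i)) :
    ∀ v : HeightOneSpectrum (𝓞 ℚ), v.residueCard = 1951 → ∀ 𝔓 ∈ v.primesAbove,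
      ∃ g : Equiv.Perm (Fin 5), orderOf g = 5 ∧
        (𝔓.inertia (absoluteGaloisGroup ℚ)).map e₀ = Subgroup.zpowers g ∧
        (𝔓.decompositionSubgroup (absoluteGaloisGroup ℚ)).map e₀ = Subgroup.zpowers g := by
  -- the kernel of `e₀` is the (finite) intersection of the open stabilisers of the roots
  have hker : IsOpen ((e₀.ker : Subgroup (absoluteGaloisGroup ℚ)) : Set (absoluteGaloisGroup ℚ)) := by
    have hset : ((e₀.ker : Subgroup (absoluteGaloisGroup ℚ)) : Set (absoluteGaloisGroup ℚ)) =
        ⋂ i, (MulAction.stabilizer (absoluteGaloisGroup ℚ) (θ i) :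
          Set (absoluteGaloisGroup ℚ)) := by
      ext σ
      simp only [SetLike.mem_coe, MonoidHom.mem_ker, Set.mem_iInter,
        MulAction.mem_stabilizer_iff]
      constructor
      · intro h i
        rw [he₀ σ i, h, Equiv.Perm.coe_one, id_eq]
      · intro h
        exact Equiv.ext fun i => by
          rw [Equiv.Perm.coe_one, id_eq]
          exact hinj ((he₀ σ i).symm.trans (h i))
    rw [hset]
    exact isOpen_iInter_of_finite fun i => absIntegers.isOpen_stabilizer (𝓞 ℚ) (θ i)
  intro v hv 𝔓 h𝔓
  obtain ⟨s, -, hI⟩ := dmLocal1951_inertia_map_eq_zpowers e₀ hker v hv 𝔓 h𝔓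
  have h5 : 5 ∣ orderOf (e₀ s) := by
    have := dmLocal1951_five_dvd_card_inertia_map θ hroot hinj hall e₀ he₀ v hv 𝔓 h𝔓
    rwa [hI, Nat.card_zpowers] at this
  have hord := perm_five_orderOf_eq_five_of_dvd _ h5
  exact ⟨e₀ s, hord, hI, dmLocal1951_decomposition_map_eq_zpowers e₀ hker v hv 𝔓 h𝔓 _ hord hI⟩

end Summit.Langlands.Langlands.Theorems.QuarterDeficit1951

end
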